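import Summits.BirchSwinnertonDyer.BirchSwinnertonDyer.Theorems.ManinLocalTwoThreeKummerCubeRootSigmaIdentification
import Summits.BirchSwinnertonDyer.Rank1Residual.ManinAdditive.UDCKummerWitnessLine
import Literature.NumberTheory.EllipticCurves.ModularCurveManinConstantProofs
import Literature.NumberTheory.EllipticCurves.FormalLogExpBaseChangeProofs
import HarnessLib

/-!
# (DICT) prelims: (AN2-b) for a GIVEN lift, and the two parameter germs `t_s`, `t_W∘φ` as analytic `q`-germs with identified Taylor series
(route `ManinLocalTwoThree`, crux C3 `ManinPrimeToThreeAtNine` stmt-BirchSwinnertonDyer-22968; cell bsd-f2-manin, C3 LEAD p1 gen 16;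
`--supports stmt-BirchSwinnertonDyer-22968`; first of two files proving piece (DICT) `UDCKummerWitnessLine.KummerMinimalDictionary` of -an g38's
typed witness line, p729921 — the assembly is `Theorems/ManinLocalTwoThreeKummerMinimalDictionary.lean`)

* §1 `exists_hasSum_const_mul_shortT_mul_sigmaCubeRoot_of_lift` — p2's (AN2-b) `KummerCubeRootDictionary.exists_hasSum_const_mul_shortT_mul_sigmaCubeRoot`
  (p727852) RE-RUN FOR A GIVEN LIFT `u` (the landed statement produces its own lift by S6; its proof — S3 `sigmaTangentLineIdentity`, S3′
  `tangentLineScaling`, `exists_analytic_shortT_mul_sigmaCubeRoot`, (AN2-a) `exists_hasSum_cubeRoot_kummerCubeSeries`, formal uniqueness of cube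
  roots — uses of the lift only `u ∉ Λ`, `3u ∈ Λ`, the two coordinates and `℘'(u) ≠ 0`, the last from `2u, 3u ∈ Λ ⇒ u ∈ Λ`):
  `Σ hₙqⁿ = κ₀·t_s·W_{u,e}(w)` (`HasSum`, `Im τ > B`), `w = c·E_f(τ)`, `e = m₁η₁ + m₂η₂`, `κ₀ ≠ 0`.  This is the ∀-lift form that (DICT)/(INV)/(WL)
  quantify over (ref1 §R174 prover note).
* §2 `exists_qGerm_shortT`: `Z = t_{E_{W,c}, c⁻¹Λ} ∘ ε` is analytic at `0`, `Z(0) = 0`, `𝓣[Z] = z` (THE short germ, `IsParamGerm`) and `Z(𝕢₁τ) = t_s(τ)`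
  high in the strip; `exists_qGerm_minimalParam`: `Z_W = t_{W, Λ} ∘ (c·ε)` is analytic at `0`, `Z_W(0) = 0`, `𝓣[Z_W] = z_W := exp_W(c·Σ aₙqⁿ/n)` and
  `Z_W(𝕢₁τ) = minimalParam D τ = (t_W∘φ)(τ)` off `φ⁻¹(O)` (engines: `taylorAt0_locT` = the tree's `taylor_localParam_eq_formalExp`, `taylorAt0_comp`,
  `taylorAt0_qGerm`, `isNeron_shortModel` / `D.isNeronLattice`, homothety `℘_{c⁻¹Λ}(v) = c²℘_Λ(cv)`).
HONEST FRAMING.  Bookkeeping toward (DICT); BSD is not proved by this; Manin's conjecture is not proved; C2 and C3 remain OPEN.  No definitions, no sorry.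
[folklore] [cite: SilvermanAEC2009, IV.1 (the local parameter `z = −x/y` and its formal expansion) and VI.3 (σ-function)]
-/

set_option autoImplicit false
-- lint-debt: the directory name repeats the summit name (sibling precedent `ManinLocalTwoThreeKummerCubeRootSigmaIdentification.lean`)
set_option linter.dupNamespace false

noncomputable section

open scoped Topology PeriodPair
open Complex Filter PowerSeries
open UpperHalfPlane hiding I
open WeierstrassCurve Literature.NumberTheory.EllipticCurves Literature.NumberTheory.EllipticCurves.ModularForms
open Summit.BirchSwinnertonDyer.Rank1Residual.ManinAdditive.CuspidalKummer
open Summit.BirchSwinnertonDyer.Rank1Residual.ManinAdditive.CuspidalKummerThree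
open Summit.BirchSwinnertonDyer.Rank1Residual.ManinAdditive.KummerCubeMonodromy
open Summit.BirchSwinnertonDyer.Rank1Residual.ManinAdditive.UDCKummerWitnessLine
open Summit.BirchSwinnertonDyer.BirchSwinnertonDyer.Theorems.ManinLocalTwoThree.KummerCubeAnalytic
open Summit.BirchSwinnertonDyer.BirchSwinnertonDyer.Theorems.ManinLocalTwoThree.KummerCubeSigmaLeaves
open Summit.BirchSwinnertonDyer.BirchSwinnertonDyer.Theorems.ManinLocalTwoThree.KummerCubeRootDictionary

namespace Summit.BirchSwinnertonDyer.BirchSwinnertonDyer.Theorems.ManinLocalTwoThree.MinimalDictionary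

/-! ### §1 (AN2-b) for a GIVEN lift `u` -/

/-- **(AN2-b) for a prescribed lift**: for `u ∉ Λ` with `3u = m₁ω₁ + m₂ω₂`, `c²℘(u) = X₀`, `c³℘'(u)/2 = Y₀`, THE germ `z` and any formal
cube root `h` of `Θ_T(z)` with `h(0) = −1`, there are `κ ≠ 0` and `B` with `Σ hₙ𝕢₁(τ)ⁿ = κ·t_s(τ)·W_{u, m₁η₁+m₂η₂}(c·E_f(τ))` for `Im τ > B`.
(p2's `exists_hasSum_const_mul_shortT_mul_sigmaCubeRoot`, p727852, with the S6-lift replaced by the given one; proof adapted verbatim.) [folklore] -/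
theorem exists_hasSum_const_mul_shortT_mul_sigmaCubeRoot_of_lift
    (W : WeierstrassCurve ℚ) [W.IsElliptic] [W.IsGloballyMinimal] {N : ℕ} [NeZero N]
    (D : ModularParametrizationData W N) (a : ℕ → ℤ) (ha : ∀ n, (a n : ℂ) = cuspCoeff D.f n)
    (X₀ Y₀ : ℚ) {u : ℂ} (hu : u ∉ D.L.lattice) {m₁ m₂ : ℤ} (hm : 3 * u = m₁ * D.L.ω₁ + m₂ * D.L.ω₂)
    (hX : (D.c : ℂ) ^ 2 * ℘[D.L] u = (X₀ : ℂ)) (hY : (D.c : ℂ) ^ 3 * ℘'[D.L] u / 2 = (Y₀ : ℂ))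
    (z : ℚ⟦X⟧) (hz : IsParamGerm W D.c a z)
    (h : ℚ⟦X⟧) (hh3 : h ^ 3 = kummerCubeSeries W D.c X₀ Y₀ z) (hh0 : constantCoeff h = -1) :
    ∃ (κ : ℂ) (B : ℝ), κ ≠ 0 ∧ ∀ τ : ℍ, B < τ.im →
      HasSum (fun n : ℕ => ((coeff n h : ℚ) : ℂ) * Function.Periodic.qParam 1 (τ : ℂ) ^ n)
        (κ * (shortT D τ * sigmaCubeRoot D.L u (m₁ * D.L.η₁ + m₂ * D.L.η₂) ((D.c : ℂ) * eichlerIntegral D.f τ))) := by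
  -- adapted from `KummerCubeRootDictionary.exists_hasSum_const_mul_shortT_mul_sigmaCubeRoot` (p2 g17, p727852)
  have hc0 : D.c ≠ 0 := D.maninConstant_ne_zero_holds
  have hc : (D.c : ℂ) ≠ 0 := Int.cast_ne_zero.mpr hc0
  -- `℘'(u) ≠ 0`: otherwise `2u ∈ Λ`, and with `3u ∈ Λ` also `u ∈ Λ`
  have h3u : 3 * u ∈ D.L.lattice := PeriodPair.mem_lattice.mpr ⟨m₁, m₂, hm.symm⟩
  have h℘'u : ℘'[D.L] u ≠ 0 := by
    intro h0
    have h2 := D.L.two_mul_mem_lattice_of_derivWeierstrassP_eq_zero hu h0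
    apply hu
    have := D.L.lattice.sub_mem h3u h2
    rwa [show (3 : ℂ) * u - 2 * u = u by ring] at this
  set e : ℂ := m₁ * D.L.η₁ + m₂ * D.L.η₂ with he
  -- S3 and S3′
  obtain ⟨C, hC0, hS3⟩ := sigmaTangentLineIdentity D.L u m₁ m₂ hu hm
  have hS3' := tangentLineScaling W D X₀ Y₀ u hX hY h℘'u
  -- prelims: `t_s·W = Φ(w)` with `Φ` analytic at `0`
  obtain ⟨Φ, P₃, hΦan, hΦ0, hP₃d, hP₃0, hΦeq⟩ := exists_analytic_shortT_mul_sigmaCubeRoot D hc0 hu e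
  -- AN2-a: the holomorphic cube root `R` with `q`-coefficients `hₙ`
  obtain ⟨R, B₁, hRan, hR0, hR⟩ := exists_hasSum_cubeRoot_kummerCubeSeries W D a ha hc0 X₀ Y₀ z hz h hh3 hh0
  -- `q → 0`: `w = c·ε(q) ∉ Λ` and `P₃(w) ≠ 0`
  have hf1 : cuspCoeff D.f 1 = 1 := by
    rw [D.isNewformOf.2 1, W.isMultiplicative_LFunction.map_one]; simp
  have hev := eventually_smul_qGerm_notMem D.f hf1 D.L hc hP₃d.continuous.continuousAt (by rw [hP₃0]; norm_num)
  obtain ⟨B₂, hB₂⟩ := exists_im_bound_of_eventually hev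
  -- the cube identity high in the strip: `R(q)³ = K·Φ(w)³`, `K = c³C`
  set K : ℂ := (D.c : ℂ) ^ 3 * C with hK
  set Ψ : ℂ → ℂ := fun q => Φ ((D.c : ℂ) * qGerm D.f q) with hΨ
  have hΨan : AnalyticAt ℂ Ψ 0 := by
    have hinner : AnalyticAt ℂ (fun q : ℂ => (D.c : ℂ) * qGerm D.f q) 0 :=
      analyticAt_const.mul (analyticAt_qGerm D.f)
    have h0 : (fun q : ℂ => (D.c : ℂ) * qGerm D.f q) 0 = 0 := by simp [qGerm_zero]
    have hcomp : AnalyticAt ℂ (Φ ∘ fun q : ℂ => (D.c : ℂ) * qGerm D.f q) 0 := hΦan.comp_of_eq hinner h0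
    rw [hΨ]
    exact hcomp
  have hΨ0 : Ψ 0 = Φ 0 := by simp [hΨ, qGerm_zero]
  have hΨτ : ∀ τ : ℍ, Ψ (Function.Periodic.qParam 1 (τ : ℂ)) = Φ ((D.c : ℂ) * eichlerIntegral D.f τ) := by
    intro τ; simp [hΨ, qGerm_apply]
  have hcube : ∀ τ : ℍ, max B₁ B₂ < τ.im →
      R (Function.Periodic.qParam 1 (τ : ℂ)) ^ 3 = K * Ψ (Function.Periodic.qParam 1 (τ : ℂ)) ^ 3 := by
    intro τ hτ
    have h1 : B₁ < τ.im := (le_max_left _ _).trans_lt hτ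
    have h2 : B₂ < τ.im := (le_max_right _ _).trans_lt hτ
    obtain ⟨hwΛ, hP₃w⟩ := hB₂ τ h2
    rw [qGerm_apply] at hwΛ hP₃w
    rw [(hR τ h1).2.1, hS3' τ, hS3 _ hwΛ, hΨτ, ← hΦeq τ hwΛ hP₃w, hK]
    ring
  have hev3 : ∀ᶠ q in 𝓝[≠] (0 : ℂ), R q ^ 3 = K * Ψ q ^ 3 := eventually_nhdsWithin_of_forall_im_gt hcube
  -- at `q = 0` by continuity, hence on a full neighbourhood
  have h0 : R 0 ^ 3 = K * Ψ 0 ^ 3 :=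
    eq_at_zero_of_eventuallyEq (F := fun q => R q ^ 3) (G := fun q => K * Ψ q ^ 3)
      (hRan.continuousAt.pow 3) (continuousAt_const.mul (hΨan.continuousAt.pow 3)) hev3
  have hfull : ∀ᶠ q in 𝓝 (0 : ℂ), R q ^ 3 = K * Ψ q ^ 3 := by
    have h' := eventually_nhdsWithin_iff.mp hev3
    filter_upwards [h'] with q hq
    by_cases hq0 : q = 0
    · subst hq0; exact h0
    · exact hq hq0
  -- the constant `κ`
  have hΨ0ne : Ψ 0 ≠ 0 := by rw [hΨ0]; exact hΦ0
  set κ : ℂ := R 0 / Ψ 0 with hκdef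
  have hκ0 : κ ≠ 0 := div_ne_zero (by rw [hR0]; norm_num) hΨ0ne
  have hκ3 : κ ^ 3 = K := by
    rw [hκdef, div_pow, div_eq_iff (pow_ne_zero 3 hΨ0ne)]
    exact h0
  -- `κΨ` and `R`: equal cubes near `0`, equal values at `0`, hence equal Taylor series, hence equal near `0`
  have hGan : AnalyticAt ℂ (fun q => κ * Ψ q) 0 := analyticAt_const.mul hΨan
  have hT : taylorAt0 (fun q => κ * Ψ q) = taylorAt0 R := by
    have hpow : taylorAt0 (fun q => κ * Ψ q) ^ 3 = taylorAt0 R ^ 3 := by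
      rw [← taylorAt0_pow hGan 3, ← taylorAt0_pow hRan 3]
      apply taylorAt0_congr
      filter_upwards [hfull] with q hq
      rw [mul_pow, hκ3, hq]
    have hcc : constantCoeff (taylorAt0 (fun q => κ * Ψ q)) = constantCoeff (taylorAt0 R) := by
      rw [constantCoeff_taylorAt0, constantCoeff_taylorAt0, hκdef, div_mul_cancel₀ _ hΨ0ne]
    refine eq_of_pow_eq_of_constantCoeff_eq three_ne_zero hpow hcc ?_
    rw [hcc, constantCoeff_taylorAt0, hR0]; norm_num
  have heq := eventuallyEq_of_taylorAt0_eq hGan hRan hT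
  obtain ⟨B₃, hB₃⟩ := exists_im_bound_of_eventually (heq.filter_mono nhdsWithin_le_nhds)
  -- assemble
  refine ⟨κ, max (max B₁ B₂) B₃, hκ0, fun τ hτ => ?_⟩
  have h12 : max B₁ B₂ < τ.im := (le_max_left _ _).trans_lt hτ
  have h1 : B₁ < τ.im := (le_max_left _ _).trans_lt h12
  have h2 : B₂ < τ.im := (le_max_right _ _).trans_lt h12
  have h3 : B₃ < τ.im := (le_max_right _ _).trans_lt hτ
  obtain ⟨hwΛ, hP₃w⟩ := hB₂ τ h2
  rw [qGerm_apply] at hwΛ hP₃w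
  have hsum := (hR τ h1).1
  rw [← hB₃ τ h3, hΨτ τ, ← hΦeq τ hwΛ hP₃w] at hsum
  exact hsum

/-! ### §2 The two parameter dictionaries as analytic `q`-germs -/

/-- **The short germ as a `q`-germ**: `Z = t_{E_{W,c}, c⁻¹Λ} ∘ ε` is analytic at `0`, `Z(0) = 0`, `𝓣[Z] = z` (THE germ), and
`Z(𝕢₁τ) = t_s(τ)` high in the strip. [folklore] -/
theorem exists_qGerm_shortT (W : WeierstrassCurve ℚ) [W.IsElliptic] {N : ℕ} [NeZero N]
    (D : ModularParametrizationData W N) (a : ℕ → ℤ) (ha : ∀ n, (a n : ℂ) = cuspCoeff D.f n) (hc0 : D.c ≠ 0)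
    (z : ℚ⟦X⟧) (hz : IsParamGerm W D.c a z) :
    ∃ Z : ℂ → ℂ, AnalyticAt ℂ Z 0 ∧ Z 0 = 0 ∧ taylorAt0 Z = z.map (algebraMap ℚ ℂ) ∧
      ∃ B : ℝ, ∀ τ : ℍ, B < τ.im → Z (Function.Periodic.qParam 1 (τ : ℂ)) = shortT D τ := by
  have hcC : (D.c : ℂ) ≠ 0 := by exact_mod_cast hc0
  set L' := D.L.mulLeft ((D.c : ℂ)⁻¹) (inv_ne_zero hcC) with hL'
  set V := (shortModel W D.c).map (algebraMap ℚ ℂ) with hV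
  obtain ⟨h₂, h₃⟩ := isNeron_shortModel W D hcC
  rw [← hL', ← hV] at h₂ h₃
  have hε := analyticAt_qGerm D.f
  have hε0 := qGerm_zero D.f
  have hta : AnalyticAt ℂ (locT L' V) 0 := analyticAt_locT L' V
  refine ⟨locT L' V ∘ qGerm D.f, ?_, ?_, ?_, ?_⟩
  · have h' : AnalyticAt ℂ (locT L' V) (qGerm D.f 0) := by rw [hε0]; exact hta
    exact h'.comp hε
  · rw [Function.comp_apply, hε0, locT_zero]
  · -- `𝓣[t ∘ ε] = exp_V(𝓣[ε]) = exp_V(log_V(z)) = z`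
    set zC : PowerSeries ℂ := z.map (algebraMap ℚ ℂ) with hzC
    have hszQ : HasSubst z := HasSubst.of_constantCoeff_zero' hz.1
    have hz0 : constantCoeff zC = 0 := by
      rw [hzC, ← coeff_zero_eq_constantCoeff_apply, coeff_map, coeff_zero_eq_constantCoeff_apply, hz.1, map_zero]
    have hsz : HasSubst zC := HasSubst.of_constantCoeff_zero' hz0
    set ℓ : PowerSeries ℂ := PowerSeries.mk fun n => cuspCoeff D.f n / n with hℓ
    have hlog : V.formalLog.subst zC = ℓ := by
      have h := congrArg (PowerSeries.map (algebraMap ℚ ℂ)) hz.2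
      rw [map_subst_univ hszQ, WeierstrassCurve.map_formalLog] at h
      rw [hV, hzC, h, hℓ]
      ext n
      rw [coeff_map, lSeriesLog, coeff_mk, coeff_mk, ← ha n]
      simp
    have hsL : HasSubst V.formalLog := HasSubst.of_constantCoeff_zero' V.constantCoeff_formalLog
    have hexp : V.formalExp.subst ℓ = zC := by
      rw [← hlog, ← PowerSeries.subst_comp_subst_apply hsL hsz, V.formalExp_subst_formalLog, PowerSeries.subst_X hsz]
    rw [taylorAt0_comp hta hε hε0, taylorAt0_locT L' V h₂ h₃, taylorAt0_qGerm, ← hℓ, hexp]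
  · obtain ⟨B, hB⟩ := exists_im_bound W D hcC one_pos
    refine ⟨B, fun τ hτ => ?_⟩
    obtain ⟨hτΛ, -⟩ := hB τ hτ
    set w := eichlerIntegral D.f τ with hw
    have hP : ℘[L'] w = (D.c : ℂ) ^ 2 * ℘[D.L] ((D.c : ℂ) * w) := by
      have h := PeriodPair.weierstrassP_mulLeft ((D.c : ℂ)⁻¹) (inv_ne_zero hcC) D.L ((D.c : ℂ) * w)
      rw [inv_mul_cancel_left₀ hcC, inv_pow, inv_inv] at h
      exact h
    have hP' : ℘'[L'] w = (D.c : ℂ) ^ 3 * ℘'[D.L] ((D.c : ℂ) * w) := by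
      have h := PeriodPair.derivWeierstrassP_mulLeft ((D.c : ℂ)⁻¹) (inv_ne_zero hcC) D.L ((D.c : ℂ) * w)
      rw [inv_mul_cancel_left₀ hcC, inv_pow, inv_inv] at h
      exact h
    have ha₁ : V.a₁ = 0 := by simp [hV, shortModel]
    have ha₃ : V.a₃ = 0 := by simp [hV, shortModel]
    have hb₂ : V.b₂ = 0 := by simp [hV, shortModel, WeierstrassCurve.b₂]
    have hτΛ' : w ∉ L'.lattice := hτΛ
    rw [Function.comp_apply, qGerm_apply, ← hw, locT, if_neg hτΛ', hb₂, ha₁, ha₃, hP, hP', shortT, shortX, shortY, ← hw]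
    ring

/-- **The minimal germ as a `q`-germ**: `Z_W = t_{W, Λ} ∘ (c·ε)` is analytic at `0`, `Z_W(0) = 0`, `𝓣[Z_W] = z_W = exp_W(c·Σaₙqⁿ/n)`, and
`Z_W(𝕢₁τ) = (t_W∘φ)(τ) = minimalParam D τ` off `φ⁻¹(O)`. [folklore] -/
theorem exists_qGerm_minimalParam (W : WeierstrassCurve ℚ) [W.IsElliptic] {N : ℕ} [NeZero N]
    (D : ModularParametrizationData W N) (a : ℕ → ℤ) (ha : ∀ n, (a n : ℂ) = cuspCoeff D.f n) (hc0 : D.c ≠ 0) :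
    ∃ ZW : ℂ → ℂ, AnalyticAt ℂ ZW 0 ∧ ZW 0 = 0 ∧
      taylorAt0 ZW = PowerSeries.map (algebraMap ℚ ℂ) (W.formalExp.subst ((D.c : ℚ) • lSeriesLog a) : ℚ⟦X⟧) ∧
      ∀ τ : ℍ, (D.c : ℂ) * eichlerIntegral D.f τ ∉ D.L.lattice →
        ZW (Function.Periodic.qParam 1 (τ : ℂ)) = minimalParam D τ := by
  have hcC : (D.c : ℂ) ≠ 0 := by exact_mod_cast hc0
  set V := W.baseChange ℂ with hV
  obtain ⟨h₂, h₃⟩ := D.isNeronLattice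
  rw [← hV] at h₂ h₃
  set ε : ℂ → ℂ := fun q => (D.c : ℂ) * qGerm D.f q with hεdef
  have hε : AnalyticAt ℂ ε 0 := analyticAt_const.mul (analyticAt_qGerm D.f)
  have hε0 : ε 0 = 0 := by simp [hεdef, qGerm_zero]
  have hta : AnalyticAt ℂ (locT D.L V) 0 := analyticAt_locT D.L V
  refine ⟨locT D.L V ∘ ε, ?_, ?_, ?_, ?_⟩
  · have h' : AnalyticAt ℂ (locT D.L V) (ε 0) := by rw [hε0]; exact hta
    exact h'.comp hε
  · rw [Function.comp_apply, hε0, locT_zero]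
  · -- `𝓣[t ∘ (c·ε)] = exp_V(c·𝓣[ε]) = (exp_W(c·Σaₙqⁿ/n)) ⊗ ℂ`
    have hTε : taylorAt0 ε = C (D.c : ℂ) * taylorAt0 (qGerm D.f) := by
      rw [hεdef]
      exact Literature.NumberTheory.Transcendental.AndreCriterion.taylor_const_mul (D.c : ℂ) (qGerm D.f)
    have hcL0 : constantCoeff ((D.c : ℚ) • lSeriesLog a) = 0 := by
      rw [← coeff_zero_eq_constantCoeff_apply, coeff_smul, coeff_zero_eq_constantCoeff_apply, lSeriesLog,
        ← coeff_zero_eq_constantCoeff_apply, coeff_mk]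
      simp
    have hsQ : HasSubst ((D.c : ℚ) • lSeriesLog a) := HasSubst.of_constantCoeff_zero' hcL0
    have hmapL : ((D.c : ℚ) • lSeriesLog a).map (algebraMap ℚ ℂ) = C (D.c : ℂ) * taylorAt0 (qGerm D.f) := by
      rw [taylorAt0_qGerm]
      ext n
      rw [coeff_map, coeff_smul, coeff_C_mul, lSeriesLog, coeff_mk, coeff_mk, ← ha n, smul_eq_mul]
      simp
    rw [taylorAt0_comp hta hε hε0, taylorAt0_locT D.L V h₂ h₃, hTε, map_subst_univ hsQ, hmapL, hV,
      WeierstrassCurve.baseChange, WeierstrassCurve.map_formalExp]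
  · intro τ hw
    set w : ℂ := (D.c : ℂ) * eichlerIntegral D.f τ with hw_def
    have hεq : ε (Function.Periodic.qParam 1 (τ : ℂ)) = w := by simp [hεdef, qGerm_apply, hw_def]
    rw [Function.comp_apply, hεq, locT, if_neg hw]
    have ha₁ : V.a₁ = (W.a₁ : ℂ) := by simp [hV, WeierstrassCurve.baseChange]
    have ha₃ : V.a₃ = (W.a₃ : ℂ) := by simp [hV, WeierstrassCurve.baseChange]
    have hb₂ : V.b₂ = (W.b₂ : ℂ) := by simp [hV, WeierstrassCurve.baseChange]
    rw [ha₁, ha₃, hb₂]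
    have hnum : (D.c : ℂ) * (shortX D τ - (D.c : ℂ) ^ 2 * (W.b₂ : ℂ) / 12) =
        (D.c : ℂ) ^ 3 * (℘[D.L] w - (W.b₂ : ℂ) / 12) := by
      rw [shortX, ← hw_def]; ring
    have hden : minimalY D τ =
        (D.c : ℂ) ^ 3 * ((℘'[D.L] w - (W.a₁ : ℂ) * (℘[D.L] w - (W.b₂ : ℂ) / 12) - (W.a₃ : ℂ)) / 2) := by
      rw [minimalY, shortX, shortY, ← hw_def]; ring
    rw [minimalParam, hnum, hden, neg_div, neg_div, mul_div_mul_left _ _ (pow_ne_zero 3 hcC)]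

end Summit.BirchSwinnertonDyer.BirchSwinnertonDyer.Theorems.ManinLocalTwoThree.MinimalDictionary

end
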